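import Mathlib
import Summits.Ventures.HodgeRepro2.T6N5FockBundle
import Summits.Ventures.HodgeRepro2.T6N5LocalHypSmooth

/-!
# T6N5FockSmooth — condition (b) at the real places from t6-p8's RESTRICTED Epsilon-Dichotomy display
(`Hyp.BFGYYZ2025_Thm3_5_smooth`, T6N5LocalHypSmooth p416876) — Tier 6, M2 sub-step N5 (t6-p7), proof lane

t6-p8's l. 12120 finding (the display `Hyp.BFGYYZ2025_Thm3_5` quantifies over EVERY homomorphism where the print's
«Let α : K¹ → ℂ^× be a character» means a continuous character of the compact group K¹) and the lead's ruling
l. 12245 (2) (future compositions consume the statements of record v2 over the restricted display) are answered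
here for the REAL PLACES of the N5 lane: on the archimedean carrier of `T6N5RealPlace` (`Char := Wt =
Multiplicative ℤ`, the weights — exactly the continuous unitary characters z ↦ (z/|z|)^k of ℂ^× modulo |·|) EVERY
character is smooth, so the restricted display with `Sm := fun _ => True` is the full display on that carrier
(`thm3_5_of_smooth_true`, one line), and `SignModel.realCondB_of_bundle` (T6N5FockBundle p413410) re-reads as
`SignModel.realCondB_of_bundle_smooth` with the two Epsilon-Dichotomy binders in the RESTRICTED form — the shape a
v8 takes if the cell wants the real-place instances on the same display as the finite places.  Non-vacuity: the
toy bundle's real-place data satisfy the restricted display (`Toy.toyReal₁_thm3_5_smooth`, from the accepted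
`toyReal₁_thm3_5` through t6-p8's `BFGYYZ2025_Thm3_5_smooth_of`) and (b) at the real places follows on it
(`Toy.bundle_joint_smooth`).  Nothing of p402766 / p410050 / p411341 / p412347 / p412663 / p413410 / p416876 is
touched; no new display; statements of record unchanged.
§8(d): uses an L-value-free non-vanishing device: NO.
-/

namespace Summit.Ventures.HodgeRepro2.T6.N5Fock

open Summit.Ventures.HodgeRepro2.T6.N5LocalDatum Summit.Ventures.HodgeRepro2.T6.Hyp
  Summit.Ventures.HodgeRepro2.T6.N5RealPlace Summit.Ventures.HodgeRepro2.T6.N5Rich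

/-- On a carrier where every character is smooth (`Sm := fun _ => True` — the weight carrier `Wt` of the real
places, whose characters are the continuous unitary characters of ℂ^× modulo |·|), the restricted display IS the
full display. -/
theorem thm3_5_of_smooth_true (D : LocalSignDatum)
    (h : BFGYYZ2025_Thm3_5_smooth D (fun _ => True)) : BFGYYZ2025_Thm3_5 D :=
  fun s α hα => h s α hα trivial

/-- The two directions together: on such a carrier the restricted and the full display are equivalent. -/
theorem thm3_5_smooth_true_iff (D : LocalSignDatum) :
    BFGYYZ2025_Thm3_5_smooth D (fun _ => True) ↔ BFGYYZ2025_Thm3_5 D :=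
  ⟨thm3_5_of_smooth_true D, BFGYYZ2025_Thm3_5_smooth_of D _⟩

end Summit.Ventures.HodgeRepro2.T6.N5Fock

namespace Summit.Ventures.HodgeRepro2.T6.N5Rich.SignModel

open Summit.Ventures.HodgeRepro2.T6.N5LocalDatum Summit.Ventures.HodgeRepro2.T6.N5Rich
  Summit.Ventures.HodgeRepro2.T6.Hyp Summit.Ventures.HodgeRepro2.T6.N5RealPlace
  Summit.Ventures.HodgeRepro2.T6.N5Fock

/-- CONDITION (b) AT THE REAL PLACES FROM THE BUNDLE AND THE DISPLAYS BY NAME, the Epsilon Dichotomy taken in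
t6-p8's RESTRICTED form (`Hyp.BFGYYZ2025_Thm3_5_smooth … (fun _ => True)` — on the weight carrier every
character is smooth): `realCondB_of_bundle` with its two `h35` binders re-read through `thm3_5_of_smooth_true`. -/
theorem realCondB_of_bundle_smooth {ι : Type*} (S : SignModel ι) (B : RealPlaceBundle ι)
    (hS : S = B.signModel S.kind S.D S.ξ)
    (h35A : ∀ v, S.kind v = .re → BFGYYZ2025_Thm3_5_smooth (B.RA v).toLocal (fun _ => True))
    (h35B : ∀ v, S.kind v = .re → BFGYYZ2025_Thm3_5_smooth (B.RB v).toLocal (fun _ => True))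
    (h54A : ∀ v, S.kind v = .re → KonnoKonno2007_Thm5_4_i_lines (B.CA v))
    (h54B : ∀ v, S.kind v = .re → KonnoKonno2007_Thm5_4_i_lines (B.CB v))
    (h51A : ∀ v, S.kind v = .re → KonnoKonno2007_Fact5_1_compact (B.CA v))
    (h51B : ∀ v, S.kind v = .re → KonnoKonno2007_Fact5_1_compact (B.CB v)) :
    S.RealCondB :=
  S.realCondB_of_bundle B hS (fun v hv => thm3_5_of_smooth_true _ (h35A v hv))
    (fun v hv => thm3_5_of_smooth_true _ (h35B v hv)) h54A h54B h51A h51B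

end Summit.Ventures.HodgeRepro2.T6.N5Rich.SignModel

namespace Summit.Ventures.HodgeRepro2.T6.N5Fock

open Summit.Ventures.HodgeRepro2.T6.N5LocalDatum Summit.Ventures.HodgeRepro2.T6.N5Rich
  Summit.Ventures.HodgeRepro2.T6.Hyp Summit.Ventures.HodgeRepro2.T6.N5RealPlace

/-! ## Non-vacuity (README §10.5(ii)(c)/(d)) -/

namespace Toy

/-- The restricted display on the toy real-place datum (from the accepted full display). -/
theorem toyReal₁_thm3_5_smooth : BFGYYZ2025_Thm3_5_smooth toyReal₁.toLocal (fun _ => True) :=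
  BFGYYZ2025_Thm3_5_smooth_of _ _ toyReal₁_thm3_5

/-- JOINT NON-VACUITY of `realCondB_of_bundle_smooth`: on the sign model built on the toy bundle every display
binder holds in the restricted form and (b) at the real places follows. -/
theorem bundle_joint_smooth {ι : Type*} (kind : ι → PlaceKind) (D : ι → LocalSignDatum)
    (ξ : ∀ v, Fin 4 → (D v).Char) :
    (∀ v, BFGYYZ2025_Thm3_5_smooth ((bundle ι).RA v).toLocal (fun _ => True)) ∧
      (∀ v, BFGYYZ2025_Thm3_5_smooth ((bundle ι).RB v).toLocal (fun _ => True)) ∧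
      (∀ v, KonnoKonno2007_Thm5_4_i_lines ((bundle ι).CA v)) ∧
      (∀ v, KonnoKonno2007_Fact5_1_compact ((bundle ι).CA v)) ∧
      ((bundle ι).signModel kind D ξ).RealCondB :=
  ⟨fun _ => toyReal₁_thm3_5_smooth, fun _ => toyReal₁_thm3_5_smooth, fun _ => carrier_kTypeHalfLine,
    fun _ => carrier_howeCompact,
    ((bundle ι).signModel kind D ξ).realCondB_of_bundle_smooth (bundle ι) rfl
      (fun _ _ => toyReal₁_thm3_5_smooth) (fun _ _ => toyReal₁_thm3_5_smooth)
      (fun _ _ => carrier_kTypeHalfLine) (fun _ _ => carrier_kTypeHalfLine)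
      (fun _ _ => carrier_howeCompact) (fun _ _ => carrier_howeCompact)⟩

end Toy

end Summit.Ventures.HodgeRepro2.T6.N5Fock
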